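import Summits.BirchSwinnertonDyer.BirchSwinnertonDyer.Theorems.SchneiderFreeAdditiveX3KYBranchThreeBROfTree
import HarnessLib

/-!
# Route `SchneiderFreeAdditiveX3` (K1 door): the `p = 3` NON-ANOMALOUS column WITHOUT [BR3], part 2 — [INV.λ≤], Keller–Yin Thm. 3.5.1 in branch
# currency and H3♭ᶜ at a ♭-frame, with the Rubin–Hida λ-clauses of the residual pair DISPLAYED AT THE DATUM instead of the named fact
# `KellerYin2024.thm122_charLambda_pair_three` (FILE 2 of generation 42's [BR3] re-key; twins of generation 40's F39a §2 / F39b §1)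

Cell `bsd-schneider-ideate`, seat `bsd-schneider-door-c5` (prover, generation 42; assembly layer; `--supports` 19177).  PARTITION: board row
B6 ∩ X3 ∩ sst-twist, `r = 1`, (G-ord, `e = 2`) half at `p = 3`, NON-ANOMALOUS twist (686 of 2 411 pairs; class-wide) of `Rank1Residual.partition` —
ASSEMBLY; types-the-object-of nothing new; RE-KEYS `KYBranchThreeOfCGLS.exists_firstUnitCoeffAt_le_lambdaInvariant_three` /
`xac_charIdeal_map_eq_span_three_of_dvd` / `xac_charIdeal_map_le_span_three_of_dvd` (F39a §2) and `KYBranchThreeDoorOfCGLS.xac_charIdeal_map_le_span_three_self_of_dvd`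
(F39b §1) off the named fact [BR3]: its conclusion at the datum — `FirstUnitCoeffAt Lφ n_φ` and `λ(G.X) = n_φ` for every strict primitive dual datum `G` of
`θsub` and of `θquot` — becomes two HYPOTHESES `hnφ`, `hchar` threaded next to the Katz frame; FILE 1 (`KYBranchThreeBROfTree.exists_aux3br_of_thm212`)
PRODUCES them from cell `bsd-eis`'s [BR𝟙]/[BRω] roads on the tree's Milne ADT I 4.10 (a) and the `grSelmer = unrSelmer` transfer; FILE 3 consumes them.
Proofs token-identical to F39a/F39b except that the [BR3] instantiation is replaced by `FirstUnitCoeffAt.unique`; closes none of B6's cells (BSD NOT advanced).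
bears_on: K1-door (19177 r3 `GordTwoBranchIMC`).

INPUT LEDGER of the `p = 3` NAT sub-column's algebraic side after this file: {CGLS 2022 Prop. 1.2.5 (module clause; corank clause), Prop. 14, Cor. 1.2.6 (i)(ii)}
∪ {Milne ADT I Thm. 4.10 (a) (tree)} ∪ {the λ-clauses at the datum (FILE 1: Bleher et al. 3.3.1, de Shalit II.6.4, Hida Thm. I)} — [BR3] GONE.
HONEST FRAMING: compositions of tree theorems, CONDITIONAL BY NAME on the displayed statements ([DIV.dvd], [AN3] carry Keller–Yin claim tags); no definition,
no named fact, no `sorry`; nothing analytic is formalised; nothing is closed; BSD proved for no curve; «closes rung: none».  References: [KellerYin2024b] Thm.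
3.3.6, Prop. 3.4.4, §3.5, Thm. 3.5.1; [CastellaGrossiLeeSkinner2022] Thms. 1.2.2, 2.1.2, 2.2.2, Props. 1.2.5, 14, Cor. 1.2.6; [MilneADT2006] I Thm. 4.10 (a);
[CastellaHsieh2018] §3.3, Def. 3.7, Prop. 3.8; this seat p680016 (gen 26), p755154 / p755440 (F39a/b, gen 40), FILE 1 (gen 42).
-/

set_option autoImplicit false
set_option linter.dupNamespace false -- the summit namespace `…BirchSwinnertonDyer.BirchSwinnertonDyer.Theorems` (Sub = Summit, D-0017) trips it

noncomputable section

open scoped Classical NumberField Pointwise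

open Field NumberField IsDedekindDomain WeierstrassCurve PowerSeries Rat.HeightOneSpectrum
  Literature.NumberTheory.EllipticCurves Literature.NumberTheory.EllipticCurves.GreenbergSelmer
  Literature.NumberTheory.GaloisRepresentations Literature.NumberTheory.GaloisCohomology
  Literature.NumberTheory.EllipticCurves.ModularForms Literature.NumberTheory.EllipticCurves.Rank1Residual
  Literature.NumberTheory.EllipticCurves.Rank1Residual.Typed
  Literature.NumberTheory.EllipticCurves.KellerYin2024 Literature.NumberTheory.EllipticCurves.CaiShuTian2014
  Literature.NumberTheory.QuadraticFields
  Literature.NumberTheory.IwasawaTheory Literature.NumberTheory.IwasawaTheory.Greenberg2016 Literature.NumberTheory.IwasawaTheory.Greenberg2006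
  Summit.BirchSwinnertonDyer.Rank1Residual Summit.BirchSwinnertonDyer.Rank1Residual.X11b
  Summit.BirchSwinnertonDyer.Rank1Residual.X11b.Halves
  Summit.BirchSwinnertonDyer.Rank1Residual.X11b.CongruenceLimit Summit.BirchSwinnertonDyer.Rank1Residual.Additive
  Summit.BirchSwinnertonDyer.BirchSwinnertonDyer.Theorems.SchneiderFree
  Summit.BirchSwinnertonDyer.BirchSwinnertonDyer.Theorems.SchneiderFree.Upper
  Summit.BirchSwinnertonDyer.BirchSwinnertonDyer.Theorems.SchneiderFree.KYRead
  Summit.BirchSwinnertonDyer.BirchSwinnertonDyer.Theorems.SchneiderFree.GoodMember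
  Summit.BirchSwinnertonDyer.BirchSwinnertonDyer.Theses.SchneiderFreeAdditiveX3
  Summit.BirchSwinnertonDyer.BirchSwinnertonDyer.Theorems.SchneiderFreeAdditiveX3.LZZMatch
  Summit.BirchSwinnertonDyer.BirchSwinnertonDyer.Theorems.SchneiderFreeAdditiveX3.ControlDischarged
  Summit.BirchSwinnertonDyer.BirchSwinnertonDyer.Theorems.SchneiderFreeAdditiveX3.KYBranchOnly
  Summit.BirchSwinnertonDyer.BirchSwinnertonDyer.Theorems.SchneiderFreeAdditiveX3.KYNonAnomalousTwist
  Summit.BirchSwinnertonDyer.BirchSwinnertonDyer.Theorems.SchneiderFreeAdditiveX3.UpperOfPrintNonAnomalousTwist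
  Summit.BirchSwinnertonDyer.BirchSwinnertonDyer.Theorems.EisensteinPrimesMuLambda
  Summit.BirchSwinnertonDyer.BirchSwinnertonDyer.Theorems.TeichmullerPairUnramifiedAtMult
  Summit.BirchSwinnertonDyer.BirchSwinnertonDyer.Theorems.KatzLineFrame
open Literature.NumberTheory.EllipticCurves.CastellaGrossiLeeSkinner2022
  (cor126_residualCharacter_globalLift cor126_residualCharacter_localSurjective
    prop125_characterGrSelmerDual_torsion_muZero_dim prop125_characterGrSelmerDual_corank_ge prop14_residualCharacterSelmer_finite
    thm212_exists_isKatzLFunction IsKatzLFunction)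

namespace Summit.BirchSwinnertonDyer.BirchSwinnertonDyer.Theorems.SchneiderFreeAdditiveX3.KYBranchThreeBROfTree

/-! ### §1 [INV.λ≤] and Keller–Yin Thm. 3.5.1 in branch currency at `p = 3`, NAT twist, with the λ-clauses displayed (twins of F39a §2) -/

section Three

open IsDedekindDomain.HeightOneSpectrum Literature.NumberTheory.EllipticCurves.IwasawaAlgebra
  Literature.NumberTheory.EllipticCurves.GreenbergVatsal2000
  Literature.NumberTheory.EllipticCurves.IwasawaDual Literature.NumberTheory.EllipticCurves.Castella2018.AcSelmer
  Summit.BirchSwinnertonDyer.Rank1Residual.X2.ResidualDevissageModules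
  Summit.BirchSwinnertonDyer.BirchSwinnertonDyer.Theorems
  Summit.BirchSwinnertonDyer.BirchSwinnertonDyer.Theorems.SchneiderFreeAdditiveX3
  Summit.BirchSwinnertonDyer.BirchSwinnertonDyer.Theorems.SchneiderFreeAdditiveX3.KYLambdaAlg
  Summit.BirchSwinnertonDyer.BirchSwinnertonDyer.Theorems.SchneiderFreeAdditiveX3.KYLambdaAlgChar
  Summit.BirchSwinnertonDyer.BirchSwinnertonDyer.Theorems.SchneiderFreeAdditiveX3.KYBranchHalves
  Summit.BirchSwinnertonDyer.BirchSwinnertonDyer.Theorems.SchneiderFreeAdditiveX3.KYLambdaAlgOfCGLS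

/-- **[INV.λ≤] ∧ KYμ at `p = 3`, non-anomalous twist, at a SIGNED Castella–Hsieh frame, Greenberg-free AND [BR3]-FREE** (the Rubin–Hida λ-clauses
`λ(𝔛_{θsub}) = λ(𝔛_{θquot}) = n_φ` are HYPOTHESES `hnφ`/`hchar` at the datum, produced from the tree by FILE 1 `exists_aux3br_of_thm212`) — generation 26's
`KYBranchThree.exists_firstUnitCoeffAt_le_lambdaInvariant_three` with the door inequality taken from the CGLS/Milne-typed cell form above: from [AN3]
`n + Σ λ𝒫_w(W_K) = 2nφ + ΣΣ`, [BR3] `λ(𝔛_{θsub}) = λ(𝔛_{θquot}) = nφ` and that inequality, `∃ n, FirstUnitCoeffAt L n ∧ n ≤ λ(X_ac^∅(W_K))`.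
[claim: KellerYin2024PotOrd, status: under-review] [cite: KellerYin2024b, §3.5 and Thm. 3.5.1 (arXiv:2410.23241 p. 20) (the λ-comparison, preprint; hypotheses)]
[cite: CastellaGrossiLeeSkinner2022, Thms. 1.2.2, 2.2.2, 2.2.4 and Props. 1.2.5, 14] [cite: MilneADT2006, I Thm. 4.10 (a)] -/
theorem exists_firstUnitCoeffAt_le_lambdaInvariant_three
    (hAN : thm351_anacong_branch_three)
    (hprop125 : prop125_characterGrSelmerDual_torsion_muZero_dim) (hge : prop125_characterGrSelmerDual_corank_ge) (hfact : prop14_residualCharacterSelmer_finite)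
    (hlift : cor126_residualCharacter_globalLift) (hlocal : cor126_residualCharacter_localSurjective)
    (hPT : ∀ (L : Type) [Field L] [NumberField L] [IsTotallyComplex L] (S : Set (HeightOneSpectrum (𝓞 L))),
      S.Finite → Literature.NumberTheory.GaloisCohomology.poitouTate_shaRestricted_tateDual_natural_at L S)
    (ι' : PadicAlgCl 3 ≃+* ℂ) (W : WeierstrassCurve ℚ) [W.IsElliptic] [W.IsGloballyMinimal]
    (K : Type) [Field K] [NumberField K] [IsGalois ℚ K]
    (v vbar : HeightOneSpectrum (𝓞 K)) (κ : ZpExtension K 3) (γ : absoluteGaloisGroup K)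
    [hγ : Fact (κ.IsTopGenerator γ)] {N : ℕ} [NeZero N] {f : CuspForm (CongruenceSubgroup.Gamma0 N) 2}
    (hf : IsNewformOf W f) (hS : PotOrdSetting ι' W K v vbar κ N)
    (hX : ClassX3 W 3) (hSG : SubGordTwo W 3)
    (hna : ∀ (V : WeierstrassCurve ℚ) [V.IsElliptic] [V.IsGloballyMinimal] (C : VariableChange ℚ),
      GoodOrd V 3 → C • V.quadraticTwist ((-1 : ℚ) ^ (3 / 2) * (3 : ℕ)) = W → ¬ (3 : ℤ) ∣ V.frobeniusTrace 3 - 1)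
    (hv3 : ((3 : ℕ) : 𝓞 K) ∈ v.asIdeal)
    {N' : ℕ} [NeZero N'] {f' : CuspForm (CongruenceSubgroup.Gamma0 N') 2} (hf' : IsNewform0 f') (hN' : ¬ 3 ∣ N')
    (htw : ∃ S : Finset ℕ, ∀ ℓ : ℕ, ℓ.Prime → ℓ ∉ S →
      cuspCoeff f ℓ = ((legendreSym 3 ℓ : ℤ) : ℂ) * cuspCoeff f' ℓ)
    {θsub θquot : FramedGaloisRep K (padicCoeffIntegers (∅ : Set (PadicAlgCl 3))) 1}
    (hpair : IsResidualPairOver (W.baseChange K) 3 θsub θquot)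
    {θ₀ : FramedGaloisRep K (padicCoeffIntegers (∅ : Set (PadicAlgCl 3))) 1} (hθ₀ : θ₀ = θsub ∨ θ₀ = θquot)
    {θ₀K : HeckeCharacter K} (hθ₀K : IsHeckeCharOf ι' θ₀ θ₀K) (hv0 : θ₀K.IsUnramifiedAt v) (hvbar0 : θ₀K.IsUnramifiedAt vbar)
    {Cbar : Finset (HeightOneSpectrum (𝓞 K))} (hCbar : ∀ u ∈ Cbar, ¬ θ₀K.IsUnramifiedAt u)
    {ΩK' : ℂ} {Ωp' : (unrIntegers 3)ˣ} {Lφ : UnrSeries 3} (hΩK' : ΩK' ≠ 0)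
    (hLφ : IsKatzLFunction ι' v vbar Cbar κ γ θ₀K ΩK' ((Ωp' : unrIntegers 3) : ℂ_[3]) Lφ)
    {nφ : ℕ} (hnφ : FirstUnitCoeffAt Lφ nφ)
    (hchar : ∀ θ : FramedGaloisRep K (padicCoeffIntegers (∅ : Set (PadicAlgCl 3))) 1, (θ = θsub ∨ θ = θquot) →
      ∀ G : GrDualData κ (charModule (∅ : Set (PadicAlgCl 3)) θ) vbar (∅ : Set (HeightOneSpectrum (𝓞 K))) γ, lambdaInvariant 3 G.X = nφ)
    {e : ℂ} {ΩK : ℂ} {Ωp : (unrIntegers 3)ˣ} {L : UnrSeries 3} (he : e = 1 ∨ e = -1) (hΩK : ΩK ≠ 0)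
    (hL : IsBranchBDPLFunction ι' v κ γ f' (KellerYin2024.genusHeckeCharacter K 3) e ΩK ((Ωp : unrIntegers 3) : ℂ_[3]) L) :
    ∃ n : ℕ, FirstUnitCoeffAt L n ∧
      n ≤ lambdaInvariant 3 (XAc (W.baseChange K) 3 κ vbar (∅ : Set (HeightOneSpectrum (𝓞 K))) γ) := by
  obtain ⟨Sf, hSf⟩ := KYBranchThree.exists_finset_primes_over_not_three (K := K) N
  have hSf' : ∀ w : HeightOneSpectrum (𝓞 K), w ∈ Sf ↔
      (((W.conductorNorm ℤ : ℤ) : 𝓞 K) ∈ w.asIdeal ∧ ((3 : ℕ) : 𝓞 K) ∉ w.asIdeal) := by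
    rw [hS.level]; exact hSf
  -- [AN3] and [BR3]
  obtain ⟨n, nφ', hLn, hLφn', hcount⟩ := hAN ι' W K v vbar κ γ hf hS hna hf' hN' htw θsub θquot hpair Sf hSf θ₀ hθ₀ θ₀K
    hθ₀K hv0 hvbar0 Cbar hCbar ΩK' Ωp' Lφ hΩK' hLφ e ΩK Ωp L he hΩK hL
  -- the count's index IS the given first-unit index (uniqueness); the λ-clauses are HYPOTHESES here (FILE 1 produces them from the tree)
  have hnn : nφ' = nφ := hLφn'.unique hnφ
  rw [hnn] at hcount
  obtain ⟨Dsub⟩ := nonempty_grDualData_char (∅ : Set (PadicAlgCl 3)) (θ := θsub) (κ := κ) (vbar := vbar)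
    (S₀ := (∅ : Set (HeightOneSpectrum (𝓞 K)))) hγ.out
  obtain ⟨Dquot⟩ := nonempty_grDualData_char (∅ : Set (PadicAlgCl 3)) (θ := θquot) (κ := κ) (vbar := vbar)
    (S₀ := (∅ : Set (HeightOneSpectrum (𝓞 K)))) hγ.out
  have hsub : lambdaInvariant 3 Dsub.X = nφ := hchar θsub (Or.inl rfl) Dsub
  have hquot : lambdaInvariant 3 Dquot.X = nφ := hchar θquot (Or.inr rfl) Dquot
  -- the published-fact door inequality (generation 25)
  have hineq := add_add_sum_le_lambdaInvariant_xAc_empty_add_sum_curveLocalLambda_of_subGordTwo_of_forall_twist_ofCGLS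
    hprop125 hge hfact hlift hlocal hPT W K vbar κ γ Sf (by norm_num) hX hSG hna hS.imagQuad
    (by rw [hS.level]; exact hS.heegner) hS.split hv3 hS.mem_vbar hS.vbar_ne hS.anticyclotomic hSf' θsub θquot hpair Dsub Dquot
  rw [hsub, hquot] at hineq
  refine ⟨n, hLn, ?_⟩
  omega

/-- **Keller–Yin Thm. 3.5.1 (branch currency) at `p = 3` for a non-anomalous twist, at a signed frame, along any structure map `j`, Greenberg-free and [BR3]-free (the λ-clauses displayed):**
`Ch_Λ(X_ac^∅(W_K))·R₀⟦T⟧ = (L)` and the first unit coefficient of `L` sits EXACTLY at `λ(𝔛)` — from [DIV.dvd] (PREPRINT), [AN3], [BR3], CGLS ×5 and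
Milne I 4.10 (a); generation 26's theorem with §1 in place of its Greenberg-fed λ-inequality. [claim: KellerYin2024PotOrd, status: under-review]
[cite: KellerYin2024b, Thm. 3.3.6, Prop. 3.4.4, §3.5 and Thm. 3.5.1 (arXiv:2410.23241 pp. 19–20) (preprint; hypotheses and the sentence derived)]
[cite: CastellaGrossiLeeSkinner2022, Thm. 3.2.1, Thms. 1.2.2, 2.2.2, Prop. 14] [cite: MilneADT2006, I Thm. 4.10 (a)] [cite: Washington1997, §7.1 Prop. 7.2 and §13.2] -/
theorem xac_charIdeal_map_eq_span_three_of_dvd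
    (hAN : thm351_anacong_branch_three)
    (hprop125 : prop125_characterGrSelmerDual_torsion_muZero_dim) (hge : prop125_characterGrSelmerDual_corank_ge) (hfact : prop14_residualCharacterSelmer_finite)
    (hlift : cor126_residualCharacter_globalLift) (hlocal : cor126_residualCharacter_localSurjective)
    (hPT : ∀ (L : Type) [Field L] [NumberField L] [IsTotallyComplex L] (S : Set (HeightOneSpectrum (𝓞 L))),
      S.Finite → Literature.NumberTheory.GaloisCohomology.poitouTate_shaRestricted_tateDual_natural_at L S)
    (hDVD : thm336_dvd_branch_OPEN)
    (ι' : PadicAlgCl 3 ≃+* ℂ) (W : WeierstrassCurve ℚ) [W.IsElliptic] [W.IsGloballyMinimal]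
    (K : Type) [Field K] [NumberField K] [IsGalois ℚ K]
    (v vbar : HeightOneSpectrum (𝓞 K)) (κ : ZpExtension K 3) (γ : absoluteGaloisGroup K)
    [hγ : Fact (κ.IsTopGenerator γ)] {N : ℕ} [NeZero N] {f : CuspForm (CongruenceSubgroup.Gamma0 N) 2}
    (hf : IsNewformOf W f) (hS : PotOrdSetting ι' W K v vbar κ N)
    (hX : ClassX3 W 3) (hSG : SubGordTwo W 3)
    (hna : ∀ (V : WeierstrassCurve ℚ) [V.IsElliptic] [V.IsGloballyMinimal] (C : VariableChange ℚ),
      GoodOrd V 3 → C • V.quadraticTwist ((-1 : ℚ) ^ (3 / 2) * (3 : ℕ)) = W → ¬ (3 : ℤ) ∣ V.frobeniusTrace 3 - 1)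
    (hv3 : ((3 : ℕ) : 𝓞 K) ∈ v.asIdeal)
    {N' : ℕ} [NeZero N'] {f' : CuspForm (CongruenceSubgroup.Gamma0 N') 2} (hf' : IsNewform0 f') (hN' : ¬ 3 ∣ N')
    (htw : ∃ S : Finset ℕ, ∀ ℓ : ℕ, ℓ.Prime → ℓ ∉ S →
      cuspCoeff f ℓ = ((legendreSym 3 ℓ : ℤ) : ℂ) * cuspCoeff f' ℓ)
    {θsub θquot : FramedGaloisRep K (padicCoeffIntegers (∅ : Set (PadicAlgCl 3))) 1}
    (hpair : IsResidualPairOver (W.baseChange K) 3 θsub θquot)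
    {θ₀ : FramedGaloisRep K (padicCoeffIntegers (∅ : Set (PadicAlgCl 3))) 1} (hθ₀ : θ₀ = θsub ∨ θ₀ = θquot)
    {θ₀K : HeckeCharacter K} (hθ₀K : IsHeckeCharOf ι' θ₀ θ₀K) (hv0 : θ₀K.IsUnramifiedAt v) (hvbar0 : θ₀K.IsUnramifiedAt vbar)
    {Cbar : Finset (HeightOneSpectrum (𝓞 K))} (hCbar : ∀ u ∈ Cbar, ¬ θ₀K.IsUnramifiedAt u)
    {ΩK' : ℂ} {Ωp' : (unrIntegers 3)ˣ} {Lφ : UnrSeries 3} (hΩK' : ΩK' ≠ 0)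
    (hLφ : IsKatzLFunction ι' v vbar Cbar κ γ θ₀K ΩK' ((Ωp' : unrIntegers 3) : ℂ_[3]) Lφ)
    {nφ : ℕ} (hnφ : FirstUnitCoeffAt Lφ nφ)
    (hchar : ∀ θ : FramedGaloisRep K (padicCoeffIntegers (∅ : Set (PadicAlgCl 3))) 1, (θ = θsub ∨ θ = θquot) →
      ∀ G : GrDualData κ (charModule (∅ : Set (PadicAlgCl 3)) θ) vbar (∅ : Set (HeightOneSpectrum (𝓞 K))) γ, lambdaInvariant 3 G.X = nφ)
    {e : ℂ} {ΩK : ℂ} {Ωp : (unrIntegers 3)ˣ} {L : UnrSeries 3} (he : e = 1 ∨ e = -1) (hΩK : ΩK ≠ 0)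
    (hL : IsBranchBDPLFunction ι' v κ γ f' (KellerYin2024.genusHeckeCharacter K 3) e ΩK ((Ωp : unrIntegers 3) : ℂ_[3]) L)
    (j : ℤ_[3] →+* unrIntegers 3)
    (hj : ∀ x : ℤ_[3], ((j x : unrIntegers 3) : ℂ_[3]) = algebraMap ℚ_[3] ℂ_[3] (x : ℚ_[3])) :
    (XAc.charIdeal (W.baseChange K) 3 κ vbar (∅ : Set (HeightOneSpectrum (𝓞 K))) γ).map (PowerSeries.map j) =
        Ideal.span {L} ∧
      ∃ n : ℕ, FirstUnitCoeffAt L n ∧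
        n = lambdaInvariant 3 (XAc (W.baseChange K) 3 κ vbar (∅ : Set (HeightOneSpectrum (𝓞 K))) γ) := by
  obtain ⟨n, hLn, hle⟩ := exists_firstUnitCoeffAt_le_lambdaInvariant_three hAN hprop125 hge hfact hlift hlocal hPT ι' W K v vbar κ γ hf hS hX hSG hna hv3 hf' hN' htw hpair hθ₀ hθ₀K hv0 hvbar0 hCbar hΩK' hLφ hnφ hchar he hΩK hL
  -- `𝔛` torsion with `μ = 0` (CGLS Prop. 14, generation 25)
  obtain ⟨hT, hμ⟩ := isTorsion_muInvariant_eq_zero_empty_of_prop14_of_subGordTwo_of_forall_twist hfact W K vbar κ γ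
    (by norm_num) hX hSG hna hS.imagQuad (by rw [hS.level]; exact hS.heegner) hS.split hS.mem_vbar hS.anticyclotomic
  have he0 : e ≠ 0 := by rcases he with rfl | rfl <;> norm_num
  have hΩp0 : ((Ωp : unrIntegers 3) : ℂ_[3]) ≠ 0 := by
    rw [Ne, ZeroMemClass.coe_eq_zero]; exact Ωp.ne_zero
  obtain ⟨k, hk⟩ := hDVD ι' W K v vbar κ γ hf hS hf' hN' htw e ΩK _ L he0 hΩK hΩp0 hL j hj
  haveI : Module.Finite (IwasawaAlgebra 3) (XAc (W.baseChange K) 3 κ vbar (∅ : Set (HeightOneSpectrum (𝓞 K))) γ) :=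
    XAc.module_finite_empty _ 3 κ vbar γ
  obtain ⟨heq, hn⟩ := charIdeal_map_eq_span_of_C_pow_mul_mem_of_firstUnitCoeff_le _ hT hμ j hj hLn hle hk
  exact ⟨heq, n, hLn, hn⟩

/-- **The door direction H3 at the frame** (`Ch_Λ(X_ac^∅(W_K))·R₀⟦T⟧ ⊆ (L)`) at `p = 3` for a non-anomalous twist, Greenberg-free and [BR3]-free (the λ-clauses displayed).
[claim: KellerYin2024PotOrd, status: under-review] [cite: KellerYin2024b, Thm. 3.5.1 (arXiv:2410.23241 p. 20) (preprint; the door direction of its conclusion)] -/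
theorem xac_charIdeal_map_le_span_three_of_dvd
    (hAN : thm351_anacong_branch_three)
    (hprop125 : prop125_characterGrSelmerDual_torsion_muZero_dim) (hge : prop125_characterGrSelmerDual_corank_ge) (hfact : prop14_residualCharacterSelmer_finite)
    (hlift : cor126_residualCharacter_globalLift) (hlocal : cor126_residualCharacter_localSurjective)
    (hPT : ∀ (L : Type) [Field L] [NumberField L] [IsTotallyComplex L] (S : Set (HeightOneSpectrum (𝓞 L))),
      S.Finite → Literature.NumberTheory.GaloisCohomology.poitouTate_shaRestricted_tateDual_natural_at L S)
    (hDVD : thm336_dvd_branch_OPEN)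
    (ι' : PadicAlgCl 3 ≃+* ℂ) (W : WeierstrassCurve ℚ) [W.IsElliptic] [W.IsGloballyMinimal]
    (K : Type) [Field K] [NumberField K] [IsGalois ℚ K]
    (v vbar : HeightOneSpectrum (𝓞 K)) (κ : ZpExtension K 3) (γ : absoluteGaloisGroup K)
    [hγ : Fact (κ.IsTopGenerator γ)] {N : ℕ} [NeZero N] {f : CuspForm (CongruenceSubgroup.Gamma0 N) 2}
    (hf : IsNewformOf W f) (hS : PotOrdSetting ι' W K v vbar κ N)
    (hX : ClassX3 W 3) (hSG : SubGordTwo W 3)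
    (hna : ∀ (V : WeierstrassCurve ℚ) [V.IsElliptic] [V.IsGloballyMinimal] (C : VariableChange ℚ),
      GoodOrd V 3 → C • V.quadraticTwist ((-1 : ℚ) ^ (3 / 2) * (3 : ℕ)) = W → ¬ (3 : ℤ) ∣ V.frobeniusTrace 3 - 1)
    (hv3 : ((3 : ℕ) : 𝓞 K) ∈ v.asIdeal)
    {N' : ℕ} [NeZero N'] {f' : CuspForm (CongruenceSubgroup.Gamma0 N') 2} (hf' : IsNewform0 f') (hN' : ¬ 3 ∣ N')
    (htw : ∃ S : Finset ℕ, ∀ ℓ : ℕ, ℓ.Prime → ℓ ∉ S →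
      cuspCoeff f ℓ = ((legendreSym 3 ℓ : ℤ) : ℂ) * cuspCoeff f' ℓ)
    {θsub θquot : FramedGaloisRep K (padicCoeffIntegers (∅ : Set (PadicAlgCl 3))) 1}
    (hpair : IsResidualPairOver (W.baseChange K) 3 θsub θquot)
    {θ₀ : FramedGaloisRep K (padicCoeffIntegers (∅ : Set (PadicAlgCl 3))) 1} (hθ₀ : θ₀ = θsub ∨ θ₀ = θquot)
    {θ₀K : HeckeCharacter K} (hθ₀K : IsHeckeCharOf ι' θ₀ θ₀K) (hv0 : θ₀K.IsUnramifiedAt v) (hvbar0 : θ₀K.IsUnramifiedAt vbar)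
    {Cbar : Finset (HeightOneSpectrum (𝓞 K))} (hCbar : ∀ u ∈ Cbar, ¬ θ₀K.IsUnramifiedAt u)
    {ΩK' : ℂ} {Ωp' : (unrIntegers 3)ˣ} {Lφ : UnrSeries 3} (hΩK' : ΩK' ≠ 0)
    (hLφ : IsKatzLFunction ι' v vbar Cbar κ γ θ₀K ΩK' ((Ωp' : unrIntegers 3) : ℂ_[3]) Lφ)
    {nφ : ℕ} (hnφ : FirstUnitCoeffAt Lφ nφ)
    (hchar : ∀ θ : FramedGaloisRep K (padicCoeffIntegers (∅ : Set (PadicAlgCl 3))) 1, (θ = θsub ∨ θ = θquot) →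
      ∀ G : GrDualData κ (charModule (∅ : Set (PadicAlgCl 3)) θ) vbar (∅ : Set (HeightOneSpectrum (𝓞 K))) γ, lambdaInvariant 3 G.X = nφ)
    {e : ℂ} {ΩK : ℂ} {Ωp : (unrIntegers 3)ˣ} {L : UnrSeries 3} (he : e = 1 ∨ e = -1) (hΩK : ΩK ≠ 0)
    (hL : IsBranchBDPLFunction ι' v κ γ f' (KellerYin2024.genusHeckeCharacter K 3) e ΩK ((Ωp : unrIntegers 3) : ℂ_[3]) L)
    (j : ℤ_[3] →+* unrIntegers 3)
    (hj : ∀ x : ℤ_[3], ((j x : unrIntegers 3) : ℂ_[3]) = algebraMap ℚ_[3] ℂ_[3] (x : ℚ_[3])) :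
    (XAc.charIdeal (W.baseChange K) 3 κ vbar (∅ : Set (HeightOneSpectrum (𝓞 K))) γ).map (PowerSeries.map j) ≤
      Ideal.span {L} :=
  (xac_charIdeal_map_eq_span_three_of_dvd hAN hprop125 hge hfact hlift hlocal hPT hDVD ι' W K v vbar κ γ hf hS
    hX hSG hna hv3 hf' hN' htw hpair hθ₀ hθ₀K hv0 hvbar0 hCbar hΩK' hLφ hnφ hchar he hΩK hL j hj).1.le

end Three

/-! ### §2 H3♭ᶜ at a ♭-frame of the conjugate prime, with the λ-clauses displayed (twin of F39b §1) -/

section Flat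

open Summit.BirchSwinnertonDyer.Rank1Residual.X11b.AcSelmer

/-- **H3♭ᶜ at a ♭-frame of the conjugate prime at `p = 3` ⇐ [DIV.dvd] ∧ [AN3] ∧ Castella–Hsieh signed ∧ CGLS ×5 ∧ Milne I 4.10 (a) ∧ the comparison data WITH its Rubin–Hida λ-clauses — [BR3]-free**
— generation 26's `KYBranchThreeDoor.xac_charIdeal_map_le_span_three_self_of_dvd` (the Keller–Yin-normalised presented curve with non-anomalous twists, a residual pair,
a member `θ₀` unramified above `3` with its Katz frame) with step 3 on F39a's Greenberg-free `KYBranchThreeOfCGLS.xac_charIdeal_map_eq_span_three_of_dvd`.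
[claim: KellerYin2024PotOrd, status: under-review] [cite: KellerYin2024b, Thm. 3.5.1, Rem. 3.5.2 (arXiv:2410.23241 p. 20) (preprint; the Kolyvagin clause a hypothesis)]
[cite: CastellaHsieh2018, §3.3, Def. 3.7 and Prop. 3.8] [cite: CastellaGrossiLeeSkinner2022, Thms. 1.2.2, 2.1.2, 2.2.2, Props. 1.2.5, 14] [cite: MilneADT2006, I Thm. 4.10 (a)] -/
theorem xac_charIdeal_map_le_span_three_self_of_dvd
    (hCHσ : castellaHsieh2018_exists_isBranchBDPLFunction_signed)
    (hDVD : thm336_dvd_branch_OPEN) (hAN : thm351_anacong_branch_three)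
    (hprop125 : prop125_characterGrSelmerDual_torsion_muZero_dim) (hge : prop125_characterGrSelmerDual_corank_ge) (hfact : prop14_residualCharacterSelmer_finite)
    (hlift : cor126_residualCharacter_globalLift) (hlocal : cor126_residualCharacter_localSurjective)
    (hPT : ∀ (L : Type) [Field L] [NumberField L] [IsTotallyComplex L] (S : Set (HeightOneSpectrum (𝓞 L))),
      S.Finite → Literature.NumberTheory.GaloisCohomology.poitouTate_shaRestricted_tateDual_natural_at L S)
    (hmodN : exists_isNewformOf)
    -- the good partner `W′`, the presentation of the door's curve at `p = 3`
    (W' : WeierstrassCurve ℚ) [W'.IsElliptic] (hgood : W'.HasGoodReductionAtPrime 3) (D C₂ : VariableChange ℚ)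
    [(C₂ • (D • W').quadraticTwist ((-1 : ℚ) ^ (3 / 2) * (3 : ℕ))).IsElliptic]
    [(C₂ • (D • W').quadraticTwist ((-1 : ℚ) ^ (3 / 2) * (3 : ℕ))).IsGloballyMinimal] {N : ℕ} [NeZero N]
    (Dt : ModularParametrizationData (C₂ • (D • W').quadraticTwist ((-1 : ℚ) ^ (3 / 2) * (3 : ℕ))) N)
    {N' : ℕ} [NeZero N'] (Dt' : ModularParametrizationData W' N') (hpN' : ¬ 3 ∣ N')
    -- the socket's field, tower, primes, embedding datum; Heegner for `N` and for the partner's level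
    {K : Type} [Field K] [NumberField K] [IsGalois ℚ K] (hK : IsImaginaryQuadratic K)
    (hHe : SatisfiesHeegnerHypothesis N K) (hHe' : SatisfiesHeegnerHypothesis N' K)
    (hodd : Odd (NumberField.discr K)) (hdK : NumberField.discr K ≠ -3)
    {κ : ZpExtension K 3} (hκ : κ.IsAnticyclotomic) (γ : absoluteGaloisGroup K) [hγ : Fact (κ.IsTopGenerator γ)]
    {𝔭 : HeightOneSpectrum (𝓞 K)} (h𝔭 : ((3 : ℕ) : 𝓞 K) ∈ 𝔭.asIdeal)
    (he : 𝔭.asIdeal.ramificationIdx (𝓞 ℚ) = 1) (hf : 𝔭.asIdeal.inertiaDeg (𝓞 ℚ) = 1)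
    {𝔭' : HeightOneSpectrum (𝓞 K)} (h𝔭' : ((3 : ℕ) : 𝓞 K) ∈ 𝔭'.asIdeal) (hne : 𝔭 ≠ 𝔭')
    {ι' : PadicAlgCl 3 ≃+* ℂ} (hι' : BranchInducesPrime 3 ι' 𝔭')
    -- the curve ITSELF carries Keller–Yin's per-curve hypotheses, lies in the (G-ord) cell, and has non-anomalous twists
    (hN : (C₂ • (D • W').quadraticTwist ((-1 : ℚ) ^ (3 / 2) * (3 : ℕ))).conductorNorm ℤ = N)
    (hcase : (C₂ • (D • W').quadraticTwist ((-1 : ℚ) ^ (3 / 2) * (3 : ℕ))).HasGoodOrdinaryReductionOverQuadraticAt 3)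
    (hX : ClassX3 (C₂ • (D • W').quadraticTwist ((-1 : ℚ) ^ (3 / 2) * (3 : ℕ))) 3)
    (hSG : SubGordTwo (C₂ • (D • W').quadraticTwist ((-1 : ℚ) ^ (3 / 2) * (3 : ℕ))) 3)
    (hna : ∀ (V : WeierstrassCurve ℚ) [V.IsElliptic] [V.IsGloballyMinimal] (C : VariableChange ℚ),
      GoodOrd V 3 → C • V.quadraticTwist ((-1 : ℚ) ^ (3 / 2) * (3 : ℕ)) =
        C₂ • (D • W').quadraticTwist ((-1 : ℚ) ^ (3 / 2) * (3 : ℕ)) → ¬ (3 : ℤ) ∣ V.frobeniusTrace 3 - 1)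
    (hlat : ∃ Φ : AddSubgroup (geomTorsion (C₂ • (D • W').quadraticTwist ((-1 : ℚ) ^ (3 / 2) * (3 : ℕ))) (3 : ℤ)),
      IsRationalLine (C₂ • (D • W').quadraticTwist ((-1 : ℚ) ^ (3 / 2) * (3 : ℕ))) 3 Φ ∧
        ¬ LineDecompositionTrivialAt (C₂ • (D • W').quadraticTwist ((-1 : ℚ) ^ (3 / 2) * (3 : ℕ))) 3 Φ)
    (htf : ∀ Q : ((C₂ • (D • W').quadraticTwist ((-1 : ℚ) ^ (3 / 2) * (3 : ℕ))).baseChange K).toAffine.Point, 3 • Q = 0 → Q = 0)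
    -- the analytic comparison data at `(𝔭′, 𝔭, ι′)`
    {θsub θquot : FramedGaloisRep K (padicCoeffIntegers (∅ : Set (PadicAlgCl 3))) 1}
    (hpair : IsResidualPairOver ((C₂ • (D • W').quadraticTwist ((-1 : ℚ) ^ (3 / 2) * (3 : ℕ))).baseChange K) 3 θsub θquot)
    {θ₀ : FramedGaloisRep K (padicCoeffIntegers (∅ : Set (PadicAlgCl 3))) 1} (hθ₀ : θ₀ = θsub ∨ θ₀ = θquot)
    {θ₀K : HeckeCharacter K} (hθ₀K : IsHeckeCharOf ι' θ₀ θ₀K) (hv0 : θ₀K.IsUnramifiedAt 𝔭') (hvbar0 : θ₀K.IsUnramifiedAt 𝔭)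
    {Cbar : Finset (HeightOneSpectrum (𝓞 K))} (hCbar : ∀ u ∈ Cbar, ¬ θ₀K.IsUnramifiedAt u)
    {ΩK₀ : ℂ} {Ωp₀ : (unrIntegers 3)ˣ} {Lφ : UnrSeries 3} (hΩK₀ : ΩK₀ ≠ 0)
    (hLφ : IsKatzLFunction ι' 𝔭' 𝔭 Cbar κ γ θ₀K ΩK₀ ((Ωp₀ : unrIntegers 3) : ℂ_[3]) Lφ)
    {nφ : ℕ} (hnφ : FirstUnitCoeffAt Lφ nφ)
    (hchar : ∀ θ : FramedGaloisRep K (padicCoeffIntegers (∅ : Set (PadicAlgCl 3))) 1, (θ = θsub ∨ θ = θquot) →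
      ∀ G : GrDualData κ (charModule (∅ : Set (PadicAlgCl 3)) θ) 𝔭 (∅ : Set (HeightOneSpectrum (𝓞 K))) γ, lambdaInvariant 3 G.X = nφ)
    -- the ♭-frame at the conjugate prime
    {ΩK' : ℂ} {Ωp' : ℂ_[3]} {Q : PowerSeries (PadicComplexInt 3)} (hΩK' : ΩK' ≠ 0) (hΩp' : Ωp' ≠ 0)
    (hQ : R1.IsBDPLFunctionInt 3 ι' 𝔭' κ γ Dt.f ΩK' Ωp' Q) :
    (XAc.charIdeal ((C₂ • (D • W').quadraticTwist ((-1 : ℚ) ^ (3 / 2) * (3 : ℕ))).baseChange K) 3 κ 𝔭 ∅ γ).map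
        (PowerSeries.map (R1.toCpInt 3)) ≤ Ideal.span {Q} := by
  have hp2 : (3 : ℕ) ≠ 2 := by norm_num
  have hsplit : ((Ideal.span {((3 : ℕ) : ℤ)}).primesOver (𝓞 K)).ncard = 2 :=
    ncard_primesOver_eq_two_of_degreeOne hK.1 h𝔭 he hf
  have hcond : ∀ 𝔮 : HeightOneSpectrum (𝓞 K), ((3 : ℕ) : 𝓞 K) ∈ 𝔮.asIdeal →
      (KellerYin2024.genusHeckeCharacter K 3).HasConductorExponentAt 𝔮 1 := fun 𝔮 h𝔮 ↦
    KellerYin2024.genusHeckeCharacter_hasConductorExponentAt_one_of_split K 3 hp2 hK hsplit h𝔮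
  obtain ⟨e, ΩK, Ωp, L, hesign, hΩK, hL⟩ := hCHσ ι' W' K 𝔭' κ γ Dt'.isNewformOf (KellerYin2024.genusHeckeCharacter K 3) hp2
    hpN' hK hodd hdK hsplit h𝔭' hι' hHe' hκ hγ.out (KellerYin2024.genusHeckeCharacter_sq K 3)
    (fun w hw ↦ KellerYin2024.genusHeckeCharacter_isUnramifiedAt K 3 hw) hcond
  have hΩp : ((Ωp : unrIntegers 3) : ℂ_[3]) ≠ 0 := by
    rw [Ne, ZeroMemClass.coe_eq_zero]
    exact Ωp.ne_zero
  have hS : PotOrdSetting ι' (C₂ • (D • W').quadraticTwist ((-1 : ℚ) ^ (3 / 2) * (3 : ℕ))) K 𝔭' 𝔭 κ N :=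
    potOrdSetting_of_socketData hp2 ι' _ K 𝔭 𝔭' κ N hN hcase hX.1 hlat htf hK hHe hodd hdK hκ h𝔭 he hf hne hι'
  have htw : ∃ S : Finset ℕ, ∀ ℓ : ℕ, ℓ.Prime → ℓ ∉ S →
      cuspCoeff Dt.f ℓ = ((legendreSym 3 ℓ : ℤ) : ℂ) * cuspCoeff Dt'.f ℓ :=
    exists_cofinite_cuspCoeff_eq_legendreSym_mul hp2 W' D C₂ Dt Dt'
  have heq := (xac_charIdeal_map_eq_span_three_of_dvd hAN hprop125 hge hfact hlift hlocal hPT hDVD ι'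
    _ K 𝔭' 𝔭 κ γ Dt.isNewformOf hS hX hSG hna h𝔭' Dt'.isNewformOf.1 hpN' htw hpair hθ₀ hθ₀K hv0 hvbar0 hCbar hΩK₀ hLφ hnφ hchar
    hesign hΩK hL (toUnr 3) (coe_toUnr 3)).1
  have hdiv : (XAc.charIdeal ((C₂ • (D • W').quadraticTwist ((-1 : ℚ) ^ (3 / 2) * (3 : ℕ))).baseChange K) 3 κ 𝔭 ∅ γ).map
      (PowerSeries.map (toUnr 3)) ≤ Ideal.span {L} := by
    rw [xac_charIdeal_eq_literature, heq]
  have hKp : Algebra.IsUnramifiedIn (𝓞 K) (Ideal.span {((3 : ℕ) : ℤ)}) := isUnramifiedIn_of_splitsTwo hK hsplit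
  obtain ⟨c, hc, -⟩ := exists_coe_eq_symm_of_sign (p := 3) (ι := ι') hesign
  have hLQ : Ideal.span {PowerSeries.map (R1.unrToCpInt 3) L} ≤ Ideal.span {Q} :=
    span_map_le_span_of_isBranchBDPLFunction_of_isBDPLFunctionInt hp2 hK hKp Dt.f Dt'.f
      (fun _ hℓ hℓp ↦ cuspCoeff_eq_legendreSym_mul_of_presentation hp2 W' D C₂ Dt.isNewformOf Dt'.isNewformOf hℓ hℓp)
      (cuspCoeff_prime_eq_zero_of_presentation hp2 W' hgood D C₂ Dt)
      (prime_dvd_level_of_presentation hmodN hp2 W' hgood D C₂ Dt)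
      (fun _ hℓ hℓp ↦ dvd_level_iff_dvd_level_partner_of_presentation hmodN hp2 W' hgood D C₂ Dt Dt' hℓ hℓp)
      hκ hγ.out hΩK hΩK' hΩp hΩp' hL hQ hc
  exact (map_toCpInt_le_span_of_map_toUnr_le_span hdiv).trans hLQ

end Flat

end Summit.BirchSwinnertonDyer.BirchSwinnertonDyer.Theorems.SchneiderFreeAdditiveX3.KYBranchThreeBROfTree

end
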